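import Summits.MatrixMultiplication.MatrixMultiplication.Theses.EisensteinValCertificates
import Summits.MatrixMultiplication.MatrixMultiplication.Theses.FourierTwoFamiliesModP
import Literature.Computability.AlgebraicComplexity.SimultaneousDoubleProduct
import Summits.MatrixMultiplication.MatrixMultiplication.Theorems.EisensteinValCertificatesHomocyclicSTPPDesignsStubCornerFreeSquares
import Summits.MatrixMultiplication.MatrixMultiplication.Theorems.EisensteinValCertificatesHomocyclicSTPPDesignsStubChartPattern
import Summits.MatrixMultiplication.MatrixMultiplication.Theorems.EisensteinValCertificatesHomocyclicSTPPDesignsStubRowsDesign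
import Summits.MatrixMultiplication.MatrixMultiplication.Theorems.EisensteinValCertificatesHomocyclicSTPPDesignsStubRowsCount
import Summits.MatrixMultiplication.MatrixMultiplication.Theorems.EisensteinValCertificatesHomocyclicSTPPDesignsStubClusteredOfPrimeTwoFamilies

/-!
# `HomocyclicSTPPDesigns` from clustered two families (line `registered`, clustered-charts reshape:
# composition + reduction)

Crux `EisensteinValCertificates.HomocyclicSTPPDesigns` (stmt-MatrixMultiplication-10647) = X′: for every
`ε > 0` some prime power `q`, some `ℓ` and some STPP family `(A_i,B_i,C_i)_{i<N}` in `(ℤ/q)^ℓ` (tree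
`IsSTPP`) with `q^ℓ < Σ_i (|A_i||B_i||C_i|)^{(2+ε)/3}`.

This support file lands the COMPOSITION of the reshaped skeleton
`Cruxes/HomocyclicSTPPDesigns/Lines/clustered_charts.lean` (idea `clustered-chart-amplification`:
CKSU 2005 Thm 37 over the SDPP pair of `ℤ/p` in three rotated roles, class word free, value pairs
in a Behrend corner-free square): its five provable stubs are landed tree theorems
(`ClusteredCharts.stub_cornerFreeSquares` p153638, `stub_chartPattern` p153566, `stub_rowsDesign`
p153980, `stub_rowsCount` p153798, `stub_clusteredOfPrimeTwoFamilies` p154020), and the one open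
stub — the existence leaf CLUSTERED TWO FAMILIES — is taken here as a HYPOTHESIS, spelled out:

  for every `ε > 0` a prime `p`, an SDPP family `(A_t,B_t)_{t<n}` in `ℤ/p` (tree `IsSDPP`) with
  `|A_t| = a`, `|B_t| = b`, `ab ≥ 2`, a class map `cls : Fin n → Fin m` whose classes have pairwise
  DISJOINT difference-set unions (`cls i ≠ cls j → Disjoint (A i − B i) (A j − B j)`) and `≥ d`
  members each, and MERIT `m · d^{2/3} · (ab)^{(2+ε)/3} > p`.

* `homocyclicSTPPDesigns_of_clusteredTwoFamilies` — the REDUCTION leaf ⟹ X′ (unconditional,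
  sorry-free): the crux stands closed modulo this single open existence statement.  For one class
  (`m = 1`, `d = n`) the leaf is CKSU Conj. 4.7 at primes up to uniformisation, and indeed
* `homocyclicSTPPDesigns_of_primeTwoFamilies_viaCharts` — `PrimeTwoFamilies → X′` again (a second,
  independent proof of the reduction landed in `…OfPrimeTwoFamilies.lean`, p149874), through
  `stub_clusteredOfPrimeTwoFamilies : PrimeTwoFamilies → leaf`; so the reshape WEAKENED the line's
  open stub: `PrimeTwoFamilies ⟹ leaf ⟹ X′ ⟹ ω = 2`.
* `not_clusteredTwoFamilies_of_noHomocyclicSTPP` — kill side: the route's negative milestone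
  `NoHomocyclicSTPP` (stmt-MatrixMultiplication-7787) refutes every clustered generalisation of
  Conj. 4.7 at once (strategist census N3/K3).

Arithmetic of the composition: leaf at `ε/2` gives the family and the merit; `d ≥ 1` because the
merit is strict (`d = 0` makes its right-hand side `0`); `stub_rowsCount` (fed with
`stub_cornerFreeSquares` and, at every width `3t`, `stub_rowsDesign ∘ stub_chartPattern`) returns an
STPP family in `Fin ℓ → ZMod p` beating `2 + 2·(ε/2) = 2 + ε`; the witness is `q := p`, `ℓ`.

Sources: H. Cohn, R. Kleinberg, B. Szegedy, C. Umans, *Group-theoretic algorithms for matrix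
multiplication*, FOCS 2005 (arXiv:math/0511460), §4 Def. 4.1, Conj. 4.7, §6 Def. 36 / Thm. 37;
K. Pratt, *On generalized corners and matrix multiplication*, ITCS 2024, §4.  The clustered leaf and
the amplification theorem are this crux chain's own (strategist gen 1, lead c3); nothing here is cited
as a published fact.
-/

set_option linter.dupNamespace false
-- (single-conjunct summit: the namespace repeats `MatrixMultiplication`)

namespace Summit.MatrixMultiplication.MatrixMultiplication.Theorems.HomocyclicSTPPDesigns.ClusteredCharts

open Summit.MatrixMultiplication.MatrixMultiplication.Theses.EisensteinValCertificates
open Summit.MatrixMultiplication.MatrixMultiplication.Theses.FourierTwoFamiliesModP (PrimeTwoFamilies)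
open Literature.Computability.AlgebraicComplexity Finset
open scoped BigOperators Pointwise

/-- **Clustered two families ⟹ `HomocyclicSTPPDesigns`** (the reduction of line `registered`,
clustered-charts reshape; unconditional).  Hypothesis = the open existence leaf
`stub_clusteredTwoFamilies` verbatim: for every `ε > 0` a prime `p` and a clustered SDPP family in
`ℤ/p` (uniform sizes `a, b` with `ab ≥ 2`, cross-class disjoint difference sets, classes of size
`≥ d`) with merit `m · d^{2/3} · (ab)^{(2+ε)/3} > p`.  Conclusion = the crux BY NAME.  Proof: the
leaf at `ε/2`, `d ≥ 1` from the strict merit, then the landed stubs `stub_rowsCount`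
(`stub_cornerFreeSquares`, `stub_rowsDesign ∘ stub_chartPattern`); witness `q := p` prime, `ℓ := 3t`. -/
theorem homocyclicSTPPDesigns_of_clusteredTwoFamilies :
    (∀ ε : ℝ, 0 < ε → ∃ p : ℕ, p.Prime ∧ ∃ (n m a b d : ℕ) (A B : Fin n → Finset (ZMod p))
      (cls : Fin n → Fin m), IsSDPP A B ∧ 2 ≤ a * b ∧ (∀ i, (A i).card = a ∧ (B i).card = b) ∧
      (∀ i j, cls i ≠ cls j → Disjoint (A i - B i) (A j - B j)) ∧
      (∀ c : Fin m, d ≤ (Finset.univ.filter fun i => cls i = c).card) ∧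
      (p : ℝ) < (m : ℝ) * (d : ℝ) ^ ((2 : ℝ) / 3) * ((a * b : ℕ) : ℝ) ^ ((2 + ε) / 3)) →
    HomocyclicSTPPDesigns := by
  intro hLeaf ε hε
  obtain ⟨p, hp, n, m, a, b, d, A, B, cls, hS, hab, hcard, hdisj, hd, hmerit⟩ :=
    hLeaf (ε / 2) (half_pos hε)
  -- the merit is strict, so `d ≥ 1`
  have hd1 : 1 ≤ d := by
    rcases Nat.eq_zero_or_pos d with h0 | hpos
    · exfalso
      subst h0
      have hz : ((0 : ℕ) : ℝ) ^ ((2 : ℝ) / 3) = 0 := by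
        rw [Nat.cast_zero]
        exact Real.zero_rpow (by norm_num)
      rw [hz, mul_zero, zero_mul] at hmerit
      exact absurd hmerit (not_lt.mpr (Nat.cast_nonneg p))
    · exact hpos
  obtain ⟨ℓ, N, A', B', C', hSTPP, hlt⟩ :=
    stub_rowsCount stub_cornerFreeSquares p m a b d hab hd1
      (fun t S hSc => stub_rowsDesign stub_chartPattern p n m d A B cls hS hdisj hd1 hd a b hcard t S hSc)
      (ε / 2) (half_pos hε) hmerit
  refine ⟨p, ℓ, hp.isPrimePow, N, A', B', C', hSTPP, ?_⟩
  have hexp : (2 + 2 * (ε / 2)) / 3 = (2 + ε) / 3 := by ring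
  rw [hexp] at hlt
  exact hlt

/-- **`PrimeTwoFamilies ⟹ HomocyclicSTPPDesigns` via the clustered charts** — a second, independent
proof of the reduction stmt-MatrixMultiplication-14308 ⟹ stmt-MatrixMultiplication-10647 (first landed
as `HomocyclicSTPPDesigns.homocyclicSTPPDesigns_of_primeTwoFamilies`, p149874, by the CKSU triangle
lift): CKSU Conj. 4.7 at primes gives the one-class case of the clustered leaf
(`stub_clusteredOfPrimeTwoFamilies`, dyadic uniformisation) and the leaf gives the crux.  Typed record
that the reshape weakened the line's open stub: `PrimeTwoFamilies ⟹ leaf ⟹ X′`. -/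
theorem homocyclicSTPPDesigns_of_primeTwoFamilies_viaCharts (hTF : PrimeTwoFamilies) :
    HomocyclicSTPPDesigns :=
  homocyclicSTPPDesigns_of_clusteredTwoFamilies (stub_clusteredOfPrimeTwoFamilies hTF)

/-- **Kill side: `NoHomocyclicSTPP` refutes the clustered leaf.**  The route's negative milestone
`NoHomocyclicSTPP` (stmt-MatrixMultiplication-7787: one `ε > 0` bounding the packing sum of EVERY STPP
family in every `(ℤ/q)^ℓ`, `q` a prime power) excludes clustered SDPP families with merit for every
`ε` — a strictly larger negative than `¬ PrimeTwoFamilies` (strategist census N3). -/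
theorem not_clusteredTwoFamilies_of_noHomocyclicSTPP (hNo : NoHomocyclicSTPP) :
    ¬ ∀ ε : ℝ, 0 < ε → ∃ p : ℕ, p.Prime ∧ ∃ (n m a b d : ℕ) (A B : Fin n → Finset (ZMod p))
      (cls : Fin n → Fin m), IsSDPP A B ∧ 2 ≤ a * b ∧ (∀ i, (A i).card = a ∧ (B i).card = b) ∧
      (∀ i j, cls i ≠ cls j → Disjoint (A i - B i) (A j - B j)) ∧
      (∀ c : Fin m, d ≤ (Finset.univ.filter fun i => cls i = c).card) ∧
      (p : ℝ) < (m : ℝ) * (d : ℝ) ^ ((2 : ℝ) / 3) * ((a * b : ℕ) : ℝ) ^ ((2 + ε) / 3) := fun h => by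
  obtain ⟨ε, hε, hbound⟩ := hNo
  obtain ⟨q, ℓ, hq, N, A, B, C, hS, hlt⟩ := homocyclicSTPPDesigns_of_clusteredTwoFamilies h ε hε
  exact absurd (hbound q ℓ hq N A B C hS) (not_le.2 hlt)

end Summit.MatrixMultiplication.MatrixMultiplication.Theorems.HomocyclicSTPPDesigns.ClusteredCharts
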